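import Summits.QuantumFields.YangMills.Theorems.LuscherReductionOneSiteLevelsClosed
import Summits.QuantumFields.YangMills.Theorems.FemtoTransferGapLevelsDecay
import Literature.Analysis.OperatorTheory.YangMillsMatrixModelDiscreteness
import Summits.QuantumFields.YangMills.Theses.LuscherReduction
import HarnessLib

/-!
# Crux RED `RunningReduction` (stmt-QuantumFields-19978), line «KTR» rev 8, registered stub `TT.stub_oneSiteTail`:
# the glue «uniform normalised-trace bound ⟹ one-site tail bound» (item stmt-QuantumFields-20204 `OneSiteTail`)

The registered stub `TT.stub_oneSiteTail` (body `TT.OneSiteTail`, skeleton `Cruxes/RunningReduction/Lines/ktr.lean`) asks for a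
`B`-UNIFORM tail bound of the normalised one-site heat trace: for every `s > 0` and `ε > 0` there are `K`, `B0` with
`Σ_k x_{k+K}(B)^T ≤ ε` (and summability) for all `B ≥ B0` and all `T` with `s ≤ 2Tλ_b(B)`, where
`x_k(B) = levelValue su2Rep 1 B k / levelValue su2Rep 1 B 0` are the normalised min–max transfer values of the one-site (`L = 1`)
`SU(2)` Wilson transfer kernel and `λ_b = bareLambda`.

This module proves, sorry-free and over tree constants only (no new definitions):

* `oneSiteTail_of_traceBound` (glue G2 of the ideator-2 split, memo `STUB-READING-oneSiteTail-ideator2.md` on the crux item): a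
  `B`-uniform BOUND `Σ_k x_k(B)^T ≤ Z(s)` of the normalised trace for `s ≤ 2Tλ_b`, `B ≥ B0(s)` already implies the tail bound.
  Proof: levels are antitone (`levelValue_le_of_le`), so for `k ≥ K`, `x_k^T ≤ x_K^{⌊T/2⌋} · x_k^{⌈T/2⌉}`; the trace bound at parameter
  `s/2` bounds `Σ_k x_k^{⌈T/2⌉} ≤ Z`; the PROVED crux ONE (`oneSiteLevels_proof`, upper half at level `K`) gives
  `x_K ≤ e^{−λ_b(Δ_K − C_Kλ_b)}`, hence `x_K^{⌊T/2⌋} ≤ e^{−(s/16)Δ_K}` once `λ_b ≤ s/4` and `|C_K|λ_b ≤ Δ_K/2`; and `Δ_K → ∞`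
  (`tendsto_physLevel_atTop`), so `K` with `e^{−(s/16)Δ_K} · max Z 1 ≤ ε` exists.
* (The route owner's door «`B`-uniform Laplace-summable domination ⟹ tail bound», turnkey scratch of ym-beyond-p1 g18, is ALREADY in the
  tree as `OSTail.oneSiteTail_of_domination`, module `Theorems.LuscherReductionRunningReductionOneSiteTailOfDomination` (p511477, seat
  ym-infvol-p2); a domination trivially gives the trace bound below, so `oneSiteTail_of_traceBound` is the weaker-hypothesis door.)

So the remaining content of the stub is ONE scalar inequality per `(B, T)`: a uniform bound on the normalised one-site partition function
(ideator-2's S0 `OneSiteTraceBound`; their further split S0 ⟸ S1 «Hilbert–Schmidt ratio» ∧ S2′ «uniform low-energy dimension bound» is the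
subject of the companion modules).  HONEST FRAMING: elementary real analysis on top of the proved crux ONE; the uniform trace bound itself is
NOT proved here; femto rung R2b1 of the ladder (one-site lattice quantum mechanics), not infinite volume, not a mass gap, not Clay.
References: Lüscher 1983 §1; Simon 1983 (Ann. Phys. 146) Thm. 1.1; Reed–Simon IV Thm. XIII.1.
-/

set_option autoImplicit false

noncomputable section

open Filter Topology
open Literature.MathematicalPhysics.QuantumFieldTheory
open Literature.MathematicalPhysics.QuantumLattice
open Literature.Analysis.OperatorTheory.YMMatrixModel

namespace Summit.QuantumFields.YangMills.Theorems.FemtoTransferGap.OSTail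

/-- `0 ≤ x_k(B) ≤ 1` for the normalised one-site transfer values (`B > 0`). -/
theorem xval_nonneg_le_one {B : ℝ} (hB : 0 < B) (k : ℕ) :
    0 ≤ levelValue su2Rep 1 B k / levelValue su2Rep 1 B 0 ∧
      levelValue su2Rep 1 B k / levelValue su2Rep 1 B 0 ≤ 1 := by
  have h0 : 0 < levelValue su2Rep 1 B 0 := levelValue_zero_su2Rep_pos 1 B
  refine ⟨div_nonneg (levelValue_su2Rep_nonneg 1 hB.le k) h0.le, ?_⟩
  rw [div_le_one h0]
  exact levelValue_le_of_le (L := 1) hB (Nat.zero_le k)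

/-- `x_·(B)` is antitone in the level (`B > 0`): `j ≤ k ⟹ x_k(B) ≤ x_j(B)`. -/
theorem xval_le_of_le {B : ℝ} (hB : 0 < B) {j k : ℕ} (hjk : j ≤ k) :
    levelValue su2Rep 1 B k / levelValue su2Rep 1 B 0 ≤ levelValue su2Rep 1 B j / levelValue su2Rep 1 B 0 :=
  div_le_div_of_nonneg_right (levelValue_le_of_le (L := 1) hB hjk) (levelValue_zero_su2Rep_pos 1 B).le

/-- The excitation coefficients `Δ_k = physLevel (k+1) − physLevel 1` of Lüscher's Hamiltonian tend to `+∞`. -/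
theorem tendsto_levelGap_atTop : Tendsto (fun k : ℕ => levelGap k) atTop atTop := by
  have h1 : Tendsto (fun k : ℕ => physLevel (k + 1)) atTop atTop :=
    tendsto_physLevel_atTop.comp (tendsto_add_atTop_nat 1)
  have h2 := tendsto_atTop_add_const_right atTop (-physLevel 1) h1
  refine h2.congr fun k => ?_
  unfold levelGap; ring

/-- ★ **Glue G2: a uniform normalised-trace bound implies the one-site tail bound** (conclusion = the body of the registered stub
`TT.OneSiteTail` verbatim).  Uses the proved crux ONE (`oneSiteLevels_proof`) at the single level `K` and `Δ_K → ∞`. -/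
theorem oneSiteTail_of_traceBound
    (hZ : ∀ s : ℝ, 0 < s → ∃ Z B0 : ℝ, ∀ B : ℝ, B0 ≤ B → ∀ T : ℕ,
      s ≤ 2 * ((T : ℝ) * bareLambda B) →
        Summable (fun k : ℕ => (levelValue su2Rep 1 B k / levelValue su2Rep 1 B 0) ^ T) ∧
        ∑' k : ℕ, (levelValue su2Rep 1 B k / levelValue su2Rep 1 B 0) ^ T ≤ Z) :
    ∀ s : ℝ, 0 < s → ∀ ε : ℝ, 0 < ε → ∃ K : ℕ, ∃ B0 : ℝ, ∀ B : ℝ, B0 ≤ B → ∀ T : ℕ,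
      s ≤ 2 * ((T : ℝ) * bareLambda B) →
        Summable (fun k : ℕ => (levelValue su2Rep 1 B k / levelValue su2Rep 1 B 0) ^ T) ∧
        ∑' k : ℕ, (levelValue su2Rep 1 B (k + K) / levelValue su2Rep 1 B 0) ^ T ≤ ε := by
  intro s hs ε hε
  obtain ⟨Z, B1, hZ1⟩ := hZ (s / 2) (by positivity)
  set M : ℝ := max Z 1 with hMdef
  have hM1 : 1 ≤ M := le_max_right _ _
  have hMpos : 0 < M := lt_of_lt_of_le one_pos hM1
  have hZM : Z ≤ M := le_max_left _ _
  -- choose the level K: Δ_K ≥ 1 and Δ_K ≥ (16/s)·log(M/ε)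
  obtain ⟨K, hK⟩ := (Filter.tendsto_atTop.1 tendsto_levelGap_atTop (max 1 (16 / s * Real.log (M / ε)))).exists
  have hK1 : 1 ≤ levelGap K := le_trans (le_max_left _ _) hK
  have hKlog : 16 / s * Real.log (M / ε) ≤ levelGap K := le_trans (le_max_right _ _) hK
  have hΔpos : 0 < levelGap K := lt_of_lt_of_le one_pos hK1
  -- the key smallness: exp(-(s/16) Δ_K) ≤ ε / M
  have hsmall : Real.exp (-(s / 16 * levelGap K)) ≤ ε / M := by
    have h1 : Real.log (M / ε) ≤ s / 16 * levelGap K := by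
      have h2 : s / 16 * (16 / s * Real.log (M / ε)) ≤ s / 16 * levelGap K :=
        mul_le_mul_of_nonneg_left hKlog (by positivity)
      have h3 : s / 16 * (16 / s * Real.log (M / ε)) = Real.log (M / ε) := by
        field_simp
      linarith
    calc Real.exp (-(s / 16 * levelGap K)) ≤ Real.exp (-Real.log (M / ε)) :=
          Real.exp_le_exp.2 (by linarith)
      _ = ε / M := by rw [Real.exp_neg, Real.exp_log (by positivity)]; field_simp
  -- crux ONE at level K
  obtain ⟨C, B2, hONE⟩ := oneSiteLevels_proof K
  -- λ_b-threshold t: |C| λ_b ≤ Δ_K / 2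
  set t : ℝ := levelGap K / (2 * (|C| + 1)) with htdef
  have htpos : 0 < t := by positivity
  have hs4 : 0 < s / 4 := by positivity
  refine ⟨K, max (max B1 B2) (max 1 (max (2 / (s / 4) ^ 3) (2 / t ^ 3))), fun B hB T hT => ?_⟩
  have hB1 : B1 ≤ B := le_trans ((le_max_left _ _).trans (le_max_left _ _)) hB
  have hB2 : B2 ≤ B := le_trans ((le_max_right _ _).trans (le_max_left _ _)) hB
  have hBone : 1 ≤ B := le_trans ((le_max_left _ _).trans (le_max_right _ _)) hB
  have hBs : 2 / (s / 4) ^ 3 ≤ B := le_trans ((le_max_left _ _).trans ((le_max_right _ _).trans (le_max_right _ _))) hB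
  have hBt : 2 / t ^ 3 ≤ B := le_trans ((le_max_right _ _).trans ((le_max_right _ _).trans (le_max_right _ _))) hB
  have hBpos : 0 < B := by linarith
  set l : ℝ := bareLambda B with hldef
  have hlpos : 0 < l := bareLambda_pos' hBpos
  have hls : l ≤ s / 4 := bareLambda_le_of_le hs4 hBs
  have hlt : l ≤ t := bareLambda_le_of_le htpos hBt
  -- split T = T₀ + T₁ with T₀ = ⌊T/2⌋
  set T₀ : ℕ := T / 2 with hT₀def
  set T₁ : ℕ := T - T / 2 with hT₁def
  have hTsum : T₀ + T₁ = T := by omega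
  have hT₁2 : T ≤ 2 * T₁ := by omega
  have hT₀2 : T ≤ 2 * T₀ + 1 := by omega
  have hT₁le : T₁ ≤ T := by omega
  have hT₁R : (T : ℝ) ≤ 2 * (T₁ : ℝ) := by exact_mod_cast hT₁2
  have hT₀R : (T : ℝ) ≤ 2 * (T₀ : ℝ) + 1 := by exact_mod_cast hT₀2
  -- trace bound at s/2 with exponent T₁
  have hwin₁ : s / 2 ≤ 2 * ((T₁ : ℝ) * l) := by
    have h1 : (T : ℝ) * l ≤ 2 * ((T₁ : ℝ) * l) := by
      have := mul_le_mul_of_nonneg_right hT₁R hlpos.le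
      linarith
    linarith
  obtain ⟨hsum₁, hle₁⟩ := hZ1 B hB1 T₁ hwin₁
  -- pointwise facts about x_k
  set x : ℕ → ℝ := fun k => levelValue su2Rep 1 B k / levelValue su2Rep 1 B 0 with hxdef
  have hx0 : ∀ k, 0 ≤ x k := fun k => (xval_nonneg_le_one hBpos k).1
  have hx1 : ∀ k, x k ≤ 1 := fun k => (xval_nonneg_le_one hBpos k).2
  have hxT_le : ∀ k, x k ^ T ≤ x k ^ T₁ := fun k => pow_le_pow_of_le_one (hx0 k) (hx1 k) hT₁le
  have hsumT : Summable (fun k : ℕ => x k ^ T) :=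
    Summable.of_nonneg_of_le (fun k => pow_nonneg (hx0 k) T) hxT_le hsum₁
  refine ⟨hsumT, ?_⟩
  -- ONE's upper bound at level K: x_K ≤ exp(-(Δ_K l - C l²))
  obtain ⟨h0pos, hup, -⟩ := hONE B hB2
  have hxK : x K ≤ Real.exp (-(levelGap K * l - C * l ^ 2)) := by
    show levelValue su2Rep 1 B K / levelValue su2Rep 1 B 0 ≤ _
    rw [div_le_iff₀ h0pos]; exact hup
  -- exponent bookkeeping: T₀ (Δ_K l - C l²) ≥ (s/16) Δ_K
  have hCl : C * l ≤ levelGap K / 2 := by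
    have h1 : C * l ≤ |C| * l := mul_le_mul_of_nonneg_right (le_abs_self C) hlpos.le
    have h2 : |C| * l ≤ |C| * t := mul_le_mul_of_nonneg_left hlt (abs_nonneg C)
    have h3 : |C| * t ≤ levelGap K / 2 := by
      rw [htdef]
      have hC1 : 0 < |C| + 1 := by positivity
      rw [show |C| * (levelGap K / (2 * (|C| + 1))) = levelGap K / 2 * (|C| / (|C| + 1)) by
        field_simp]
      have h4 : |C| / (|C| + 1) ≤ 1 := by rw [div_le_one hC1]; linarith
      calc levelGap K / 2 * (|C| / (|C| + 1)) ≤ levelGap K / 2 * 1 :=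
            mul_le_mul_of_nonneg_left h4 (by positivity)
        _ = levelGap K / 2 := mul_one _
    linarith
  have hrate : l * (levelGap K / 2) ≤ levelGap K * l - C * l ^ 2 := by
    have : levelGap K * l - C * l ^ 2 = l * (levelGap K - C * l) := by ring
    rw [this]
    exact mul_le_mul_of_nonneg_left (by linarith) hlpos.le
  have hT₀l : s / 8 ≤ (T₀ : ℝ) * l := by
    -- T₀ l ≥ (T l - l)/2 ≥ (s/2 - s/4)/2
    have h1 : (T : ℝ) * l ≤ 2 * ((T₀ : ℝ) * l) + l := by
      have := mul_le_mul_of_nonneg_right hT₀R hlpos.le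
      linarith
    linarith
  have hexpo : s / 16 * levelGap K ≤ (T₀ : ℝ) * (levelGap K * l - C * l ^ 2) := by
    have h1 : (T₀ : ℝ) * (l * (levelGap K / 2)) ≤ (T₀ : ℝ) * (levelGap K * l - C * l ^ 2) :=
      mul_le_mul_of_nonneg_left hrate (by positivity)
    have h2 : s / 8 * (levelGap K / 2) ≤ (T₀ : ℝ) * l * (levelGap K / 2) :=
      mul_le_mul_of_nonneg_right hT₀l (by positivity)
    have h3 : (T₀ : ℝ) * (l * (levelGap K / 2)) = (T₀ : ℝ) * l * (levelGap K / 2) := by ring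
    linarith
  have hxKT : x K ^ T₀ ≤ ε / M := by
    calc x K ^ T₀ ≤ Real.exp (-(levelGap K * l - C * l ^ 2)) ^ T₀ := pow_le_pow_left₀ (hx0 K) hxK T₀
      _ = Real.exp (-((T₀ : ℝ) * (levelGap K * l - C * l ^ 2))) := by
          rw [← Real.exp_nat_mul]; congr 1; ring
      _ ≤ Real.exp (-(s / 16 * levelGap K)) := Real.exp_le_exp.2 (by linarith)
      _ ≤ ε / M := hsmall
  -- termwise: x_{k+K}^T ≤ x_K^{T₀} · x_{k+K}^{T₁}
  have hterm : ∀ k, x (k + K) ^ T ≤ x K ^ T₀ * x (k + K) ^ T₁ := fun k => by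
    rw [← hTsum, pow_add]
    refine mul_le_mul_of_nonneg_right ?_ (pow_nonneg (hx0 _) _)
    exact pow_le_pow_left₀ (hx0 _) (xval_le_of_le hBpos (Nat.le_add_left K k)) T₀
  have hsum₁K : Summable (fun k : ℕ => x (k + K) ^ T₁) :=
    (summable_nat_add_iff (f := fun k : ℕ => x k ^ T₁) K).2 hsum₁
  have hsumTK : Summable (fun k : ℕ => x (k + K) ^ T) :=
    (summable_nat_add_iff (f := fun k : ℕ => x k ^ T) K).2 hsumT
  have htail₁ : ∑' k, x (k + K) ^ T₁ ≤ ∑' k, x k ^ T₁ := by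
    have h := hsum₁.sum_add_tsum_nat_add K
    have h2 : 0 ≤ ∑ i ∈ Finset.range K, x i ^ T₁ := Finset.sum_nonneg fun i _ => pow_nonneg (hx0 i) _
    linarith
  have htail₁0 : 0 ≤ ∑' k, x (k + K) ^ T₁ := tsum_nonneg fun k => pow_nonneg (hx0 _) _
  calc ∑' k, x (k + K) ^ T ≤ ∑' k, x K ^ T₀ * x (k + K) ^ T₁ :=
        Summable.tsum_le_tsum hterm hsumTK (hsum₁K.mul_left _)
    _ = x K ^ T₀ * ∑' k, x (k + K) ^ T₁ := tsum_mul_left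
    _ ≤ ε / M * ∑' k, x k ^ T₁ :=
        mul_le_mul hxKT htail₁ htail₁0 (by positivity)
    _ ≤ ε / M * M := mul_le_mul_of_nonneg_left (hle₁.trans hZM) (by positivity)
    _ = ε := div_mul_cancel₀ ε hMpos.ne'

/-- The same glue with conclusion THE ROUTE DECL `Theses.LuscherReduction.OneSiteTail` (item stmt-QuantumFields-20204) by name:
a uniform normalised-trace bound closes the item. -/
theorem oneSiteTail_route_of_traceBound
    (hZ : ∀ s : ℝ, 0 < s → ∃ Z B0 : ℝ, ∀ B : ℝ, B0 ≤ B → ∀ T : ℕ,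
      s ≤ 2 * ((T : ℝ) * bareLambda B) →
        Summable (fun k : ℕ => (levelValue su2Rep 1 B k / levelValue su2Rep 1 B 0) ^ T) ∧
        ∑' k : ℕ, (levelValue su2Rep 1 B k / levelValue su2Rep 1 B 0) ^ T ≤ Z) :
    Summit.QuantumFields.YangMills.Theses.LuscherReduction.OneSiteTail :=
  oneSiteTail_of_traceBound hZ

end Summit.QuantumFields.YangMills.Theorems.FemtoTransferGap.OSTail

end
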